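import Summits.QuantumAdvantage.AdviceFreeQNC0.UnionBoundRefutation
import Mathlib.LinearAlgebra.Basis.VectorSpace
import Mathlib.LinearAlgebra.Dimension.Constructions
import HarnessLib

/-!
# Cell qa-qnc0 (rung F-Q1, route RingFrame, crux α, line `tensor`): parity tools for matrices with
# linear columns (support file for the refutation of S1 = `LiftOneStrict`)

Generic lemmas used by `LiftOneStrictRefutation.lean` (planner qa-qnc0-p2 S1-REFUTED THEOREM A(5)):

* `even_card_of_hasDeg`: a Boolean function of `𝔽₂`-degree `≤ m − 1` on `{0,1}^m` has EVEN weight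
  (`sum_mono_eq_zero`: pair `v` with `v ⊕ e_i` for a coordinate `i` outside the monomial) — the
  concrete form of `RM(d, m)^⊥ ⊇ RM(m − d − 1, m)` that the lift-cost bound needs;
* `apply_eq_subsetPar` / `two_mul_card_filter_col`: a LINEAR column is the parity `⟨1_{I_v}, u⟩` over
  the basis rows where it is `1`, so a non-zero linear column has weight exactly `2^{m−1}`;
  `hw_eq_sum_cols`: the weight of a matrix is the sum of its column weights;
* `exists_parity_vanishing`: fewer than `n` points of `{0,1}^n` miss some non-trivial parity
  `⟨1_J, ·⟩` (finite-dimensional linear algebra over `𝔽₂`: `finrank (span) ≤ #points < n`, so a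
  non-zero functional kills the span).

WHAT THIS IS NOT: nothing on S1'/R1, `TRPlus`, α or the separation.  [folklore]
-/

namespace Summit.QuantumAdvantage.AdviceFreeQNC0

namespace TensorBlock

open Finset
open Literature.Computability.MetaComplexity Literature.Computability.MetaComplexity.Smolensky

variable {n : ℕ}

/-! ### A polynomial of degree `< m` on `{0,1}^m` has even weight -/

/-- `Σ_v x_S(v) = 0` in `𝔽₂` for `|S| < m` (pair `v` with `v ⊕ e_i`, `i ∉ S`). -/
theorem sum_mono_eq_zero {m : ℕ} {S : Finset (Fin m)} (hS : S.card < m) :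
    ∑ v : Fin m → Bool, mono (ZMod 2) S v = 0 := by
  classical
  obtain ⟨i, hi⟩ : ∃ i : Fin m, i ∉ S := by
    by_contra h
    push Not at h
    have : (univ : Finset (Fin m)).card ≤ S.card := Finset.card_le_card fun j _ => h j
    rw [Finset.card_univ, Fintype.card_fin] at this
    omega
  have hflip : ∀ v : Fin m → Bool, mono (ZMod 2) S (CubeChar.flipBit i v) = mono (ZMod 2) S v := by
    intro v
    rw [mono_apply, mono_apply]
    have : (∀ j ∈ S, CubeChar.flipBit i v j = true) ↔ ∀ j ∈ S, v j = true := by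
      refine forall₂_congr fun j hj => ?_
      unfold CubeChar.flipBit
      rw [Function.update_of_ne (ne_of_mem_of_not_mem hj hi)]
    simp only [this]
  rw [← Finset.sum_filter_add_sum_filter_not univ (fun v : Fin m → Bool => v i = true)]
  have hbij : ∑ v ∈ univ.filter (fun v : Fin m → Bool => ¬ v i = true), mono (ZMod 2) S v =
      ∑ v ∈ univ.filter (fun v : Fin m → Bool => v i = true), mono (ZMod 2) S v := by
    refine Finset.sum_bij (fun v _ => CubeChar.flipBit i v) ?_ ?_ ?_ ?_
    · intro v hv
      rw [Finset.mem_filter] at hv ⊢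
      refine ⟨Finset.mem_univ _, ?_⟩
      have hvi : v i = false := by simpa using hv.2
      unfold CubeChar.flipBit; rw [Function.update_self, hvi]; rfl
    · intro v₁ _ v₂ _ h
      rw [← CubeChar.flipBit_flipBit i v₁, h, CubeChar.flipBit_flipBit]
    · intro v hv
      refine ⟨CubeChar.flipBit i v, ?_, CubeChar.flipBit_flipBit i v⟩
      rw [Finset.mem_filter] at hv ⊢
      refine ⟨Finset.mem_univ _, ?_⟩
      unfold CubeChar.flipBit; rw [Function.update_self, hv.2]; decide
    · intro v _; exact (hflip v).symm
  rw [hbij]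
  exact CharTwo.add_self_eq_zero _

/-- **Even weight below full degree**: `#{v : g v = 1}` is even for `g` of degree `≤ m − 1`, `m ≥ 1`. -/
theorem even_card_of_hasDeg {m : ℕ} (hm : 1 ≤ m) {g : (Fin m → Bool) → Bool} (hg : HasDeg g (m - 1)) :
    Even ((univ : Finset (Fin m → Bool)).filter fun v => g v = true).card := by
  classical
  unfold HasDeg at hg
  have hsum : ∀ G ∈ lowDeg (ZMod 2) m (m - 1), ∑ v : Fin m → Bool, G v = 0 := by
    intro G hG
    rw [lowDeg_eq_span] at hG
    induction hG using Submodule.span_induction with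
    | mem f hf =>
      obtain ⟨⟨S, hS⟩, rfl⟩ := hf
      show ∑ v, mono (ZMod 2) S v = 0
      exact sum_mono_eq_zero (by omega)
    | zero => simp
    | add f f' _ _ hf hf' => simp only [Pi.add_apply, Finset.sum_add_distrib, hf, hf', add_zero]
    | smul a f _ hf => simp only [Pi.smul_apply, smul_eq_mul, ← Finset.mul_sum, hf, mul_zero]
  have h := hsum _ hg
  rw [Finset.sum_boole] at h
  exact (ZMod.natCast_eq_zero_iff_even).1 h

/-! ### Columns of a matrix with linear columns -/

/-- A linear column is the parity `⟨1_{I_v}, u⟩` over the rows `e_i` where it is `1`. -/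
theorem apply_eq_subsetPar {m L' : ℕ} {M : (Fin m → Bool) → (Fin L' → Bool) → Bool} (hM : LinCols M)
    (u : Fin m → Bool) (v : Fin L' → Bool) :
    M u v = CubeChar.subsetPar (univ.filter fun i => M (basisRow i) v = true) u := by
  classical
  have h := apply_eq_sum_basis_of_linCols hM u v
  have e : ∑ i, (if u i = true then (1 : ZMod 2) else 0) *
      (if M (basisRow i) v = true then (1 : ZMod 2) else 0) =
      (((univ.filter fun i => M (basisRow i) v = true).filter fun i => u i = true).card : ZMod 2) := by
    rw [Finset.card_filter, Nat.cast_sum, Finset.sum_filter]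
    refine Finset.sum_congr rfl fun i _ => ?_
    by_cases h1 : M (basisRow i) v = true <;> by_cases h2 : u i = true <;> simp [h1, h2]
  rw [e] at h
  unfold CubeChar.subsetPar
  set k := ((univ.filter fun i => M (basisRow i) v = true).filter fun i => u i = true).card
  cases hMuv : M u v
  · rw [hMuv] at h; simp only [Bool.false_eq_true, if_false] at h
    have hk : Even k := (ZMod.natCast_eq_zero_iff_even).1 h.symm
    rw [Nat.even_iff] at hk
    simp [hk]
  · rw [hMuv] at h; simp only [if_true] at h
    have hk : Odd k := (ZMod.natCast_eq_one_iff_odd).1 h.symm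
    rw [Nat.odd_iff] at hk
    simp [hk]

/-- Half of the cube has odd parity on a nonempty set of coordinates. -/
theorem two_mul_card_subsetPar_true {m : ℕ} {I : Finset (Fin m)} (hI : I.Nonempty) :
    2 * ((univ : Finset (Fin m → Bool)).filter fun u => CubeChar.subsetPar I u = true).card = 2 ^ m := by
  classical
  obtain ⟨i, hi⟩ := hI
  have hflip : ∀ u, CubeChar.subsetPar I (CubeChar.flipBit i u) = !CubeChar.subsetPar I u := by
    intro u
    unfold CubeChar.flipBit
    rw [CubeChar.subsetPar_update_of_mem hi]
    cases u i <;> cases CubeChar.subsetPar I u <;> rfl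
  have heq : ((univ : Finset (Fin m → Bool)).filter fun u => CubeChar.subsetPar I u = true).card =
      ((univ : Finset (Fin m → Bool)).filter fun u => ¬ CubeChar.subsetPar I u = true).card := by
    refine Finset.card_bij (fun u _ => CubeChar.flipBit i u) ?_ ?_ ?_
    · intro u hu
      rw [Finset.mem_filter] at hu ⊢
      exact ⟨Finset.mem_univ _, by rw [hflip, hu.2]; decide⟩
    · intro u₁ _ u₂ _ h
      rw [← CubeChar.flipBit_flipBit i u₁, h, CubeChar.flipBit_flipBit]
    · intro u hu
      refine ⟨CubeChar.flipBit i u, ?_, CubeChar.flipBit_flipBit i u⟩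
      rw [Finset.mem_filter] at hu ⊢
      refine ⟨Finset.mem_univ _, ?_⟩
      rw [hflip]; simpa using hu.2
  have htot := Finset.card_filter_add_card_filter_not
    (s := (univ : Finset (Fin m → Bool))) (fun u => CubeChar.subsetPar I u = true)
  rw [Finset.card_univ, Fintype.card_fun, Fintype.card_bool, Fintype.card_fin] at htot
  omega

/-- A non-zero linear column has weight `2^{m−1}`, a zero one has weight `0`. -/
theorem two_mul_card_filter_col {m L' : ℕ} {M : (Fin m → Bool) → (Fin L' → Bool) → Bool} (hM : LinCols M)
    (v : Fin L' → Bool) (hv : ∃ i, M (basisRow i) v = true) :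
    2 * ((univ : Finset (Fin m → Bool)).filter fun u => M u v = true).card = 2 ^ m := by
  classical
  have e : ((univ : Finset (Fin m → Bool)).filter fun u => M u v = true) =
      univ.filter fun u => CubeChar.subsetPar (univ.filter fun i => M (basisRow i) v = true) u = true :=
    Finset.filter_congr fun u _ => by rw [apply_eq_subsetPar hM]
  rw [e]
  obtain ⟨i, hi⟩ := hv
  exact two_mul_card_subsetPar_true ⟨i, Finset.mem_filter.2 ⟨Finset.mem_univ _, hi⟩⟩

/-- `hw` counted column by column. -/
theorem hw_eq_sum_cols {m L' : ℕ} (M : (Fin m → Bool) → (Fin L' → Bool) → Bool) :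
    hw M = ∑ v : Fin L' → Bool, ((univ : Finset (Fin m → Bool)).filter fun u => M u v = true).card := by
  classical
  unfold hw
  rw [Finset.card_filter, Fintype.sum_prod_type, Finset.sum_comm]
  refine Finset.sum_congr rfl fun v _ => ?_
  rw [Finset.card_filter]

/-! ### Linear algebra over `𝔽₂`: a small set misses a non-trivial parity -/

/-- If `Zr ⊆ {0,1}^n` has fewer than `n` points, some non-trivial parity `⟨1_J, ·⟩` vanishes on it. -/
theorem exists_parity_vanishing (Zr : Finset (Fin n → Bool)) (hZ : Zr.card < n) :
    ∃ J : Finset (Fin n), J.Nonempty ∧ ∀ q ∈ Zr, CubeChar.subsetPar J q = false := by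
  classical
  let toZ : (Fin n → Bool) → (Fin n → ZMod 2) := fun q j => if q j = true then 1 else 0
  set S : Finset (Fin n → ZMod 2) := Zr.image toZ with hS
  have hScard : S.card < n := (Finset.card_image_le).trans_lt hZ
  have hlt : Module.finrank (ZMod 2) (Submodule.span (ZMod 2) (S : Set (Fin n → ZMod 2))) <
      Module.finrank (ZMod 2) (Fin n → ZMod 2) := by
    rw [Module.finrank_fin_fun]
    exact (finrank_span_finset_le_card (R := ZMod 2) S).trans_lt hScard
  obtain ⟨f, hf0, hker⟩ := Submodule.exists_le_ker_of_lt_top _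
    (Submodule.lt_top_of_finrank_lt_finrank hlt)
  -- the functional as a parity
  set J : Finset (Fin n) := univ.filter fun j => f (fun k => if j = k then (1 : ZMod 2) else 0) ≠ 0 with hJ
  have hval : ∀ q : Fin n → Bool, f (toZ q) = ((J.filter fun j => q j = true).card : ZMod 2) := by
    intro q
    rw [LinearMap.pi_apply_eq_sum_univ f (toZ q), Finset.card_filter, Nat.cast_sum, hJ,
      Finset.sum_filter]
    refine Finset.sum_congr rfl fun j _ => ?_
    have h01 : f (fun k => if j = k then (1 : ZMod 2) else 0) = 0 ∨
        f (fun k => if j = k then (1 : ZMod 2) else 0) = 1 := by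
      generalize f (fun k => if j = k then (1 : ZMod 2) else 0) = z; revert z; decide
    rcases h01 with h0 | h1
    · rw [h0]; simp [toZ]
    · rw [h1]; by_cases hq : q j = true <;> simp [toZ, hq]
  refine ⟨J, ?_, fun q hq => ?_⟩
  · -- `f ≠ 0` forces some `f(δ_j) ≠ 0`
    by_contra hJe
    rw [Finset.not_nonempty_iff_eq_empty] at hJe
    apply hf0
    apply LinearMap.ext
    intro x
    rw [LinearMap.pi_apply_eq_sum_univ f x, LinearMap.zero_apply]
    refine Finset.sum_eq_zero fun j _ => ?_
    have : f (fun k => if j = k then (1 : ZMod 2) else 0) = 0 := by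
      by_contra h
      have : j ∈ J := Finset.mem_filter.2 ⟨Finset.mem_univ _, h⟩
      rw [hJe] at this; exact absurd this (Finset.notMem_empty j)
    rw [this, smul_zero]
  · have hmem : toZ q ∈ Submodule.span (ZMod 2) (S : Set (Fin n → ZMod 2)) :=
      Submodule.subset_span (by rw [hS, Finset.coe_image]; exact Set.mem_image_of_mem _ hq)
    have h0 : f (toZ q) = 0 := LinearMap.mem_ker.1 (hker hmem)
    rw [hval] at h0
    have hk : Even (J.filter fun j => q j = true).card := (ZMod.natCast_eq_zero_iff_even).1 h0
    rw [Nat.even_iff] at hk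
    unfold CubeChar.subsetPar
    simp [hk]

end TensorBlock

end Summit.QuantumAdvantage.AdviceFreeQNC0
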